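import Summits.CriticalPhenomena.PercolationContinuityZ3.Theorems.PercNearOneGluingNoHeavyLowerTailSahiTriangleSubmodular
import Mathlib.Tactic.Linarith
import Mathlib.Tactic.Ring
import HarnessLib

/-!
# `NoHeavyLowerTail` (crux stmt-CriticalPhenomena-4575), P2 — the triangle class with a TWO-STEP STAIRCASE member: Sahi's `C_3`

Memo SAHI-ROUTE.md §4.22 (seat `prim-masterthm-p2`, gen 7; `--supports stmt-CriticalPhenomena-4575`).  No `sorry`, no named facts, standard axioms.
Unifies and extends `…SahiTriangleSupermodular` (product member, `φ₁ = 0`) and `…SahiTriangleSubmodular` (OR member, `φ₂ = 1`).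
SETTING (class T): finite distributive lattices `α, β, γ` with FKG probability weights; `g : γ → β → ℝ`, `h : α → β → ℝ` nonnegative coordinatewise
monotone (arbitrary); third member a TWO-STEP STAIRCASE `f(c,a) = φ₁(c) + (φ₂(c) − φ₁(c))·ψ(a)`, `0 ≤ φ₁ ≤ φ₂ ≤ 1` monotone on `γ`, `ψ : α → [0,1]`
monotone (events on cubes: `f = 1_{(U₁ × 2^A) ∪ (U₂ × V)}`, `U₁ ⊆ U₂`).  THEOREM (`sahiE_three_nonneg_of_staircaseMember`): `E_3(f,g,h) ≥ 0`.
PROOF — an exact NINE-TERM IDENTITY on the block `β` (the lane's 'β-reduction + LP' method): with `P₁ = Eφ₁ ≤ P₂ = Eφ₂`, `Q = Eψ`, `R = P₂−P₁`,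
`m_b = E_c[φ₁ g_b]`, `d_b = E_c[(φ₂−φ₁) g_b]`, `n_b = E_c[(1−φ₂) g_b]`, `s_b = E_a[ψ h_b]`, `t_b = E_a[(1−ψ) h_b]` and the FKG slacks
`A_b = (1−P₁)m_b − P₁(d_b+n_b) ≥ 0`, `B_b = (1−P₂)(m_b+d_b) − P₂n_b ≥ 0`, `C_b = (1−Q)s_b − Qt_b ≥ 0`:
  `P₂·E_3 = (P₂+R(1−Q))Cov_b(m,s) + (P₁+R(1−Q))Cov_b(m,t) + P₂Cov_b(d,s) + P₂E_b[At] + (Ef)E_b[Bs] + RQ·E_b[Bt] + R·E_b[dC] + P₁E_b[d]E_b[C] + R·E_b[B]E_b[C]`,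
nine nonnegative terms; if `P₂ = 0` then `f = 0` `wC`-a.e. and `E_3 = 0`.  Corollary for three Boolean cubes (`sahiE_three_nonneg_cubes_of_staircaseMember`).
-/

noncomputable section

open scoped Classical

namespace Summit.CriticalPhenomena.PercolationContinuityZ3.Theorems

namespace SahiTriangleStaircase

open Finset
open Literature.Combinatorics.Sahi2008
open SahiChainTriangle (ex_prod3 drop_a drop_b drop_c)
open SahiTriangleSupermodular (fkg_sum sum3_bca sum3_acb sum3_cab)

section Main

variable {α β γ : Type} [Fintype α] [Fintype β] [Fintype γ]
  (wA : α → ℝ) (wB : β → ℝ) (wC : γ → ℝ) (φ₁ φ₂ : γ → ℝ) (ψ : α → ℝ) (g : γ → β → ℝ) (h : α → β → ℝ)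

/-- `P_i = E_c φ_i` (used with `φ₁` and `φ₂`). [this work] -/
def PC (φ : γ → ℝ) : ℝ := ∑ c, wC c * φ c
/-- `Q = E_a ψ`. [this work] -/
def QA : ℝ := ∑ a, wA a * ψ a
/-- `m_b = E_c[φ₁ g(·,b)]`. [this work] -/
def mB (b : β) : ℝ := ∑ c, wC c * (φ₁ c * g c b)
/-- `d_b = E_c[(φ₂ − φ₁) g(·,b)]`. [this work] -/
def dB (b : β) : ℝ := ∑ c, wC c * ((φ₂ c - φ₁ c) * g c b)
/-- `n_b = E_c[(1 − φ₂) g(·,b)]`. [this work] -/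
def nB (b : β) : ℝ := ∑ c, wC c * ((1 - φ₂ c) * g c b)
/-- `s_b = E_a[ψ h(·,b)]`. [this work] -/
def sB (b : β) : ℝ := ∑ a, wA a * (ψ a * h a b)
/-- `t_b = E_a[(1 − ψ) h(·,b)]`. [this work] -/
def tB (b : β) : ℝ := ∑ a, wA a * ((1 - ψ a) * h a b)

variable {wA wB wC φ₁ φ₂ ψ g h}

omit [Fintype α] [Fintype β] in
/-- `0 ≤ P`. [this work] -/
theorem PC_nonneg (hC0 : ∀ c, 0 ≤ wC c) {φ : γ → ℝ} (hφ0 : ∀ c, 0 ≤ φ c) : 0 ≤ PC wC φ :=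
  sum_nonneg fun c _ => mul_nonneg (hC0 c) (hφ0 c)

omit [Fintype α] [Fintype β] in
/-- `P` is monotone in `φ`. [this work] -/
theorem PC_mono (hC0 : ∀ c, 0 ≤ wC c) {φ φ' : γ → ℝ} (hle : ∀ c, φ c ≤ φ' c) : PC wC φ ≤ PC wC φ' :=
  sum_le_sum fun c _ => mul_le_mul_of_nonneg_left (hle c) (hC0 c)

omit [Fintype α] [Fintype β] in
/-- `P ≤ 1` for `φ ≤ 1` under a probability weight. [this work] -/
theorem PC_le_one (hC0 : ∀ c, 0 ≤ wC c) (hC1 : ∑ c, wC c = 1) {φ : γ → ℝ} (hφ1 : ∀ c, φ c ≤ 1) : PC wC φ ≤ 1 := by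
  calc PC wC φ ≤ ∑ c, wC c * 1 := sum_le_sum fun c _ => mul_le_mul_of_nonneg_left (hφ1 c) (hC0 c)
    _ = 1 := by simp [hC1]

omit [Fintype β] [Fintype γ] in
/-- `0 ≤ Q`. [this work] -/
theorem QA_nonneg (hA0 : ∀ a, 0 ≤ wA a) (hψ0 : ∀ a, 0 ≤ ψ a) : 0 ≤ QA wA ψ :=
  sum_nonneg fun a _ => mul_nonneg (hA0 a) (hψ0 a)

omit [Fintype β] [Fintype γ] in
/-- `Q ≤ 1`. [this work] -/
theorem QA_le_one (hA0 : ∀ a, 0 ≤ wA a) (hA1 : ∑ a, wA a = 1) (hψ1 : ∀ a, ψ a ≤ 1) : QA wA ψ ≤ 1 := by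
  calc QA wA ψ ≤ ∑ a, wA a * 1 := sum_le_sum fun a _ => mul_le_mul_of_nonneg_left (hψ1 a) (hA0 a)
    _ = 1 := by simp [hA1]

omit [Fintype α] [Fintype β] in
/-- `m_b ≥ 0`. [this work] -/
theorem mB_nonneg (hC0 : ∀ c, 0 ≤ wC c) (hφ0 : ∀ c, 0 ≤ φ₁ c) (hg0 : ∀ c b, 0 ≤ g c b) (b : β) : 0 ≤ mB wC φ₁ g b :=
  sum_nonneg fun c _ => mul_nonneg (hC0 c) (mul_nonneg (hφ0 c) (hg0 c b))

omit [Fintype α] [Fintype β] in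
/-- `m` is monotone in `b`. [this work] -/
theorem mB_mono [Preorder β] (hC0 : ∀ c, 0 ≤ wC c) (hφ0 : ∀ c, 0 ≤ φ₁ c) (hgb : ∀ c, Monotone (g c)) :
    Monotone (mB wC φ₁ g) := fun _ _ hbb =>
  sum_le_sum fun c _ => mul_le_mul_of_nonneg_left (mul_le_mul_of_nonneg_left (hgb c hbb) (hφ0 c)) (hC0 c)

omit [Fintype α] [Fintype β] in
/-- `d_b ≥ 0`. [this work] -/
theorem dB_nonneg (hC0 : ∀ c, 0 ≤ wC c) (hle : ∀ c, φ₁ c ≤ φ₂ c) (hg0 : ∀ c b, 0 ≤ g c b) (b : β) : 0 ≤ dB wC φ₁ φ₂ g b :=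
  sum_nonneg fun c _ => mul_nonneg (hC0 c) (mul_nonneg (sub_nonneg.mpr (hle c)) (hg0 c b))

omit [Fintype α] [Fintype β] in
/-- `d` is monotone in `b`. [this work] -/
theorem dB_mono [Preorder β] (hC0 : ∀ c, 0 ≤ wC c) (hle : ∀ c, φ₁ c ≤ φ₂ c) (hgb : ∀ c, Monotone (g c)) :
    Monotone (dB wC φ₁ φ₂ g) := fun _ _ hbb =>
  sum_le_sum fun c _ => mul_le_mul_of_nonneg_left (mul_le_mul_of_nonneg_left (hgb c hbb) (sub_nonneg.mpr (hle c))) (hC0 c)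

omit [Fintype α] [Fintype β] in
/-- `n_b ≥ 0`. [this work] -/
theorem nB_nonneg (hC0 : ∀ c, 0 ≤ wC c) (hφ1 : ∀ c, φ₂ c ≤ 1) (hg0 : ∀ c b, 0 ≤ g c b) (b : β) : 0 ≤ nB wC φ₂ g b :=
  sum_nonneg fun c _ => mul_nonneg (hC0 c) (mul_nonneg (sub_nonneg.mpr (hφ1 c)) (hg0 c b))

omit [Fintype β] [Fintype γ] in
/-- `s_b ≥ 0`. [this work] -/
theorem sB_nonneg (hA0 : ∀ a, 0 ≤ wA a) (hψ0 : ∀ a, 0 ≤ ψ a) (hh0 : ∀ a b, 0 ≤ h a b) (b : β) : 0 ≤ sB wA ψ h b :=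
  sum_nonneg fun a _ => mul_nonneg (hA0 a) (mul_nonneg (hψ0 a) (hh0 a b))

omit [Fintype β] [Fintype γ] in
/-- `s` is monotone in `b`. [this work] -/
theorem sB_mono [Preorder β] (hA0 : ∀ a, 0 ≤ wA a) (hψ0 : ∀ a, 0 ≤ ψ a) (hhb : ∀ a, Monotone (h a)) :
    Monotone (sB wA ψ h) := fun _ _ hbb =>
  sum_le_sum fun a _ => mul_le_mul_of_nonneg_left (mul_le_mul_of_nonneg_left (hhb a hbb) (hψ0 a)) (hA0 a)

omit [Fintype β] [Fintype γ] in
/-- `t_b ≥ 0`. [this work] -/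
theorem tB_nonneg (hA0 : ∀ a, 0 ≤ wA a) (hψ1 : ∀ a, ψ a ≤ 1) (hh0 : ∀ a b, 0 ≤ h a b) (b : β) : 0 ≤ tB wA ψ h b :=
  sum_nonneg fun a _ => mul_nonneg (hA0 a) (mul_nonneg (sub_nonneg.mpr (hψ1 a)) (hh0 a b))

omit [Fintype β] [Fintype γ] in
/-- `t` is monotone in `b`. [this work] -/
theorem tB_mono [Preorder β] (hA0 : ∀ a, 0 ≤ wA a) (hψ1 : ∀ a, ψ a ≤ 1) (hhb : ∀ a, Monotone (h a)) :
    Monotone (tB wA ψ h) := fun _ _ hbb =>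
  sum_le_sum fun a _ => mul_le_mul_of_nonneg_left (mul_le_mul_of_nonneg_left (hhb a hbb) (sub_nonneg.mpr (hψ1 a))) (hA0 a)

omit [Fintype α] [Fintype β] in
/-- Generic FKG slack on `γ`: for monotone `φ ≥ 0` and monotone `g(·,b) ≥ 0`, `E_c[φ g_b] ≥ (E φ)·E_c[g_b]`. [this work] -/
theorem slackC_nonneg [DistribLattice γ] (hC : IsFKGMeasure wC) {φ : γ → ℝ} (hφ0 : ∀ c, 0 ≤ φ c) (hφm : Monotone φ)
    (hg0 : ∀ c b, 0 ≤ g c b) (hgc : ∀ b, Monotone (fun c => g c b)) (b : β) :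
    PC wC φ * (∑ c, wC c * g c b) ≤ ∑ c, wC c * (φ c * g c b) :=
  fkg_sum hC hφ0 (fun c => hg0 c b) hφm (hgc b)

omit [Fintype β] [Fintype γ] in
/-- **`C_b = (1−Q) s_b − Q t_b = Cov_a(ψ, h(·,b)) ≥ 0`** (FKG on `α`). [this work] -/
theorem slackA_nonneg [DistribLattice α] (hA : IsFKGMeasure wA) (hψ0 : ∀ a, 0 ≤ ψ a) (hψm : Monotone ψ)
    (hh0 : ∀ a b, 0 ≤ h a b) (hha : ∀ b, Monotone (fun a => h a b)) (b : β) :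
    0 ≤ (1 - QA wA ψ) * sB wA ψ h b - QA wA ψ * tB wA ψ h b := by
  have key := fkg_sum hA hψ0 (fun a => hh0 a b) hψm (hha b)
  have e2 : (∑ a, wA a * h a b) = sB wA ψ h b + tB wA ψ h b := by
    simp only [sB, tB, ← sum_add_distrib]; exact sum_congr rfl fun a _ => by ring
  have e3 : (∑ a, wA a * (ψ a * h a b)) = sB wA ψ h b := rfl
  have e1 : (∑ a, wA a * ψ a) = QA wA ψ := rfl
  rw [e1, e2, e3, mul_add] at key
  linarith [key]

variable (wA wB wC φ₁ φ₂ ψ g h)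

set_option maxHeartbeats 1600000 in
/-- **THEOREM (triangle with a two-step staircase member).**  `α, β, γ` finite distributive lattices with FKG probability weights;
`g : γ → β → ℝ`, `h : α → β → ℝ` nonnegative coordinatewise monotone; `0 ≤ φ₁ ≤ φ₂ ≤ 1` monotone on `γ`, `ψ : α → [0,1]` monotone.  Then
Sahi's `E_3(φ₁ + (φ₂−φ₁)⊗ψ, g, h) ≥ 0` under the product weight on `α × β × γ` (events: `f = 1_{U₁×2^A ∪ U₂×V}`, `U₁ ⊆ U₂`).  Contains the
product member (`φ₁ = 0`) and the OR member (`φ₂ = 1`).  Proof: the nine-term identity of the module docstring. [this work] -/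
theorem sahiE_three_nonneg_of_staircaseMember [DistribLattice α] [DistribLattice β] [DistribLattice γ]
    (hA : IsFKGMeasure wA) (hB : IsFKGMeasure wB) (hC : IsFKGMeasure wC)
    (hφ0 : ∀ c, 0 ≤ φ₁ c) (hle : ∀ c, φ₁ c ≤ φ₂ c) (hφ1 : ∀ c, φ₂ c ≤ 1) (hφ1m : Monotone φ₁) (hφ2m : Monotone φ₂)
    (hψ0 : ∀ a, 0 ≤ ψ a) (hψ1 : ∀ a, ψ a ≤ 1) (hψm : Monotone ψ)
    (hg0 : ∀ c b, 0 ≤ g c b) (hgb : ∀ c, Monotone (g c)) (hgc : ∀ b, Monotone (fun c => g c b))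
    (hh0 : ∀ a b, 0 ≤ h a b) (hha : ∀ b, Monotone (fun a => h a b)) (hhb : ∀ a, Monotone (h a)) :
    0 ≤ sahiE (fun p : α × β × γ => wA p.1 * wB p.2.1 * wC p.2.2) 3
        ![fun p => φ₁ p.2.2 + (φ₂ p.2.2 - φ₁ p.2.2) * ψ p.1, fun p => g p.2.2 p.2.1, fun p => h p.1 p.2.1] := by
  rw [sahiE_three]
  simp only [ex_prod3, Pi.mul_apply]
  set Sms := ∑ b, wB b * (mB wC φ₁ g b * sB wA ψ h b) with hSms
  set Smt := ∑ b, wB b * (mB wC φ₁ g b * tB wA ψ h b) with hSmt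
  set Sds := ∑ b, wB b * (dB wC φ₁ φ₂ g b * sB wA ψ h b) with hSds
  set Sdt := ∑ b, wB b * (dB wC φ₁ φ₂ g b * tB wA ψ h b) with hSdt
  set Sns := ∑ b, wB b * (nB wC φ₂ g b * sB wA ψ h b) with hSns
  set Snt := ∑ b, wB b * (nB wC φ₂ g b * tB wA ψ h b) with hSnt
  set Sm := ∑ b, wB b * mB wC φ₁ g b with hSm
  set Sd := ∑ b, wB b * dB wC φ₁ φ₂ g b with hSd
  set Sn := ∑ b, wB b * nB wC φ₂ g b with hSn
  set Ss := ∑ b, wB b * sB wA ψ h b with hSs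
  set St := ∑ b, wB b * tB wA ψ h b with hSt
  set P1 := PC wC φ₁ with hP1
  set P2 := PC wC φ₂ with hP2
  set Q := QA wA ψ with hQ
  have gsplit : ∀ b, (∑ c, wC c * g c b) = mB wC φ₁ g b + dB wC φ₁ φ₂ g b + nB wC φ₂ g b := fun b => by
    simp only [mB, dB, nB, ← sum_add_distrib]; exact sum_congr rfl fun c _ => by ring
  have g2split : ∀ b, (∑ c, wC c * (φ₂ c * g c b)) = mB wC φ₁ g b + dB wC φ₁ φ₂ g b := fun b => by
    simp only [mB, dB, ← sum_add_distrib]; exact sum_congr rfl fun c _ => by ring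
  have g1 : ∀ b, (∑ c, wC c * (φ₁ c * g c b)) = mB wC φ₁ g b := fun b => rfl
  have gd : ∀ b, (∑ c, wC c * ((φ₂ c - φ₁ c) * g c b)) = dB wC φ₁ φ₂ g b := fun b => rfl
  have hsplit : ∀ b, (∑ a, wA a * h a b) = sB wA ψ h b + tB wA ψ h b := fun b => by
    simp only [sB, tB, ← sum_add_distrib]; exact sum_congr rfl fun a _ => by ring
  have hψ : ∀ b, (∑ a, wA a * (ψ a * h a b)) = sB wA ψ h b := fun b => rfl
  have hA1 := hA.sum_eq_one; have hB1 := hB.sum_eq_one; have hC1 := hC.sum_eq_one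
  -- the seven expectations
  have eF : (∑ a, ∑ b, ∑ c, wA a * wB b * wC c * (φ₁ c + (φ₂ c - φ₁ c) * ψ a)) = P1 + (P2 - P1) * Q := by
    rw [drop_b wA wB wC hB1 fun a c => φ₁ c + (φ₂ c - φ₁ c) * ψ a]
    have : (∑ a, ∑ c, wA a * wC c * (φ₁ c + (φ₂ c - φ₁ c) * ψ a)) =
        (∑ a, ∑ c, wA a * (wC c * φ₁ c)) + ((∑ a, ∑ c, (wA a * ψ a) * (wC c * φ₂ c)) - ∑ a, ∑ c, (wA a * ψ a) * (wC c * φ₁ c)) := by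
      rw [← sum_sub_distrib, ← sum_add_distrib]
      refine sum_congr rfl fun a _ => ?_
      rw [← sum_sub_distrib, ← sum_add_distrib]
      exact sum_congr rfl fun c _ => by ring
    rw [this, ← sum_mul_sum, ← sum_mul_sum, ← sum_mul_sum, hA1, one_mul, hP1, hP2, hQ, PC, PC, QA]
    ring
  have eG : (∑ a, ∑ b, ∑ c, wA a * wB b * wC c * g c b) = Sm + Sd + Sn := by
    rw [drop_a wA wB wC hA1 fun b c => g c b, hSm, hSd, hSn, ← sum_add_distrib, ← sum_add_distrib]
    refine sum_congr rfl fun b _ => ?_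
    rw [← mul_add, ← mul_add, ← gsplit b, mul_sum]
    exact sum_congr rfl fun c _ => by ring
  have eH : (∑ a, ∑ b, ∑ c, wA a * wB b * wC c * h a b) = Ss + St := by
    rw [drop_c wA wB wC hC1 h, sum_comm, hSs, hSt, ← sum_add_distrib]
    refine sum_congr rfl fun b _ => ?_
    rw [← mul_add, ← hsplit b, mul_sum]
    exact sum_congr rfl fun a _ => by ring
  have eGH : (∑ a, ∑ b, ∑ c, wA a * wB b * wC c * (g c b * h a b)) = Sms + Smt + Sds + Sdt + Sns + Snt := by
    rw [sum3_bca]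
    have : ∀ b, (∑ c, ∑ a, wA a * wB b * wC c * (g c b * h a b)) =
        wB b * ((∑ c, wC c * g c b) * ∑ a, wA a * h a b) := fun b => by
      rw [sum_mul_sum, mul_sum]
      refine sum_congr rfl fun c _ => ?_
      rw [mul_sum]
      exact sum_congr rfl fun a _ => by ring
    simp only [this, gsplit, hsplit, hSms, hSmt, hSds, hSdt, hSns, hSnt, ← sum_add_distrib]
    exact sum_congr rfl fun b _ => by ring
  have eFGH : (∑ a, ∑ b, ∑ c, wA a * wB b * wC c * ((φ₁ c + (φ₂ c - φ₁ c) * ψ a) * g c b * h a b)) = Sms + Smt + Sds := by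
    rw [sum3_bca]
    have : ∀ b, (∑ c, ∑ a, wA a * wB b * wC c * ((φ₁ c + (φ₂ c - φ₁ c) * ψ a) * g c b * h a b)) =
        wB b * ((∑ c, wC c * (φ₁ c * g c b)) * (∑ a, wA a * h a b)
          + (∑ c, wC c * ((φ₂ c - φ₁ c) * g c b)) * ∑ a, wA a * (ψ a * h a b)) := fun b => by
      rw [sum_mul_sum, sum_mul_sum, ← sum_add_distrib, mul_sum]
      refine sum_congr rfl fun c _ => ?_
      rw [← sum_add_distrib, mul_sum]
      exact sum_congr rfl fun a _ => by ring
    simp only [this, g1, gd, hsplit, hψ, hSms, hSmt, hSds, ← sum_add_distrib]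
    exact sum_congr rfl fun b _ => by ring
  have eFH : (∑ a, ∑ b, ∑ c, wA a * wB b * wC c * ((φ₁ c + (φ₂ c - φ₁ c) * ψ a) * h a b)) =
      P1 * (Ss + St) + (P2 - P1) * Ss := by
    rw [sum3_bca]
    have : ∀ b, (∑ c, ∑ a, wA a * wB b * wC c * ((φ₁ c + (φ₂ c - φ₁ c) * ψ a) * h a b)) =
        wB b * ((∑ c, wC c * φ₁ c) * (∑ a, wA a * h a b)
          + ((∑ c, wC c * φ₂ c) - ∑ c, wC c * φ₁ c) * ∑ a, wA a * (ψ a * h a b)) := fun b => by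
      rw [← sum_sub_distrib, sum_mul_sum, sum_mul_sum, ← sum_add_distrib, mul_sum]
      refine sum_congr rfl fun c _ => ?_
      rw [← sum_add_distrib, mul_sum]
      exact sum_congr rfl fun a _ => by ring
    simp only [this, hsplit, hψ]
    rw [hSs, hSt, hP1, hP2, PC, PC, mul_add, mul_sum, mul_sum, mul_sum, ← sum_add_distrib, ← sum_add_distrib]
    exact sum_congr rfl fun b _ => by ring
  have eFG : (∑ a, ∑ b, ∑ c, wA a * wB b * wC c * ((φ₁ c + (φ₂ c - φ₁ c) * ψ a) * g c b)) = Sm + Q * Sd := by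
    rw [sum3_bca]
    have : ∀ b, (∑ c, ∑ a, wA a * wB b * wC c * ((φ₁ c + (φ₂ c - φ₁ c) * ψ a) * g c b)) =
        wB b * ((∑ c, wC c * (φ₁ c * g c b)) * (∑ a, wA a * (1 : ℝ))
          + (∑ c, wC c * ((φ₂ c - φ₁ c) * g c b)) * ∑ a, wA a * ψ a) := fun b => by
      rw [sum_mul_sum, sum_mul_sum, ← sum_add_distrib, mul_sum]
      refine sum_congr rfl fun c _ => ?_
      rw [← sum_add_distrib, mul_sum]
      exact sum_congr rfl fun a _ => by ring
    have h1 : (∑ a, wA a * (1 : ℝ)) = 1 := by simp [hA1]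
    simp only [this, h1, g1, gd]
    rw [hSm, hSd, hQ, QA, mul_sum, ← sum_add_distrib]
    exact sum_congr rfl fun b _ => by ring
  rw [eF, eG, eH, eGH, eFGH, eFH, eFG]
  have hB0 := hB.nonneg
  have hφ20 : ∀ c, 0 ≤ φ₂ c := fun c => (hφ0 c).trans (hle c)
  have m0 := mB_nonneg (β := β) hC.nonneg hφ0 hg0
  have d0 := dB_nonneg (β := β) hC.nonneg hle hg0
  have n0 := nB_nonneg (β := β) hC.nonneg hφ1 hg0
  have s0 := sB_nonneg (β := β) hA.nonneg hψ0 hh0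
  have t0 := tB_nonneg (β := β) hA.nonneg hψ1 hh0
  have T1 : Sm * Ss ≤ Sms := fkg_sum hB m0 s0 (mB_mono hC.nonneg hφ0 hgb) (sB_mono hA.nonneg hψ0 hhb)
  have T2 : Sm * St ≤ Smt := fkg_sum hB m0 t0 (mB_mono hC.nonneg hφ0 hgb) (tB_mono hA.nonneg hψ1 hhb)
  have T3 : Sd * Ss ≤ Sds := fkg_sum hB d0 s0 (dB_mono hC.nonneg hle hgb) (sB_mono hA.nonneg hψ0 hhb)
  have hP10 : 0 ≤ P1 := PC_nonneg hC.nonneg hφ0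
  have hP12 : P1 ≤ P2 := PC_mono hC.nonneg hle
  have hP21 : P2 ≤ 1 := PC_le_one hC.nonneg hC1 hφ1
  have hQ0 : 0 ≤ Q := QA_nonneg hA.nonneg hψ0
  have hQ1 : Q ≤ 1 := QA_le_one hA.nonneg hA1 hψ1
  have hSd0 : 0 ≤ Sd := sum_nonneg fun b _ => mul_nonneg (hB0 b) (d0 b)
  -- slacks: A_b = (1-P1) m - P1 (d+n) ≥ 0, B_b = (1-P2)(m+d) - P2 n ≥ 0, C_b ≥ 0
  have Aslack : ∀ b, 0 ≤ (1 - P1) * mB wC φ₁ g b - P1 * (dB wC φ₁ φ₂ g b + nB wC φ₂ g b) := fun b => by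
    have := slackC_nonneg (β := β) hC hφ0 hφ1m hg0 hgc b
    rw [gsplit b, g1 b, ← hP1] at this
    nlinarith [this]
  have Bslack : ∀ b, 0 ≤ (1 - P2) * (mB wC φ₁ g b + dB wC φ₁ φ₂ g b) - P2 * nB wC φ₂ g b := fun b => by
    have := slackC_nonneg (β := β) hC hφ20 hφ2m hg0 hgc b
    rw [gsplit b, g2split b, ← hP2] at this
    nlinarith [this]
  have Cslack : ∀ b, 0 ≤ (1 - Q) * sB wA ψ h b - Q * tB wA ψ h b := fun b => by
    have := slackA_nonneg (β := β) hA hψ0 hψm hh0 hha b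
    rw [← hQ] at this; exact this
  -- the six "slack" atoms, nonnegative
  have U4 : 0 ≤ (1 - P1) * Smt - P1 * (Sdt + Snt) := by   -- E_b[A t]
    have : (1 - P1) * Smt - P1 * (Sdt + Snt) =
        ∑ b, wB b * (((1 - P1) * mB wC φ₁ g b - P1 * (dB wC φ₁ φ₂ g b + nB wC φ₂ g b)) * tB wA ψ h b) := by
      rw [hSmt, hSdt, hSnt, ← sum_add_distrib, mul_sum, mul_sum, ← sum_sub_distrib]
      exact sum_congr rfl fun b _ => by ring
    rw [this]; exact sum_nonneg fun b _ => mul_nonneg (hB0 b) (mul_nonneg (Aslack b) (t0 b))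
  have U5 : 0 ≤ (1 - P2) * (Sms + Sds) - P2 * Sns := by   -- E_b[B s]
    have : (1 - P2) * (Sms + Sds) - P2 * Sns =
        ∑ b, wB b * (((1 - P2) * (mB wC φ₁ g b + dB wC φ₁ φ₂ g b) - P2 * nB wC φ₂ g b) * sB wA ψ h b) := by
      rw [hSms, hSds, hSns, ← sum_add_distrib, mul_sum, mul_sum, ← sum_sub_distrib]
      exact sum_congr rfl fun b _ => by ring
    rw [this]; exact sum_nonneg fun b _ => mul_nonneg (hB0 b) (mul_nonneg (Bslack b) (s0 b))
  have U6 : 0 ≤ (1 - P2) * (Smt + Sdt) - P2 * Snt := by   -- E_b[B t]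
    have : (1 - P2) * (Smt + Sdt) - P2 * Snt =
        ∑ b, wB b * (((1 - P2) * (mB wC φ₁ g b + dB wC φ₁ φ₂ g b) - P2 * nB wC φ₂ g b) * tB wA ψ h b) := by
      rw [hSmt, hSdt, hSnt, ← sum_add_distrib, mul_sum, mul_sum, ← sum_sub_distrib]
      exact sum_congr rfl fun b _ => by ring
    rw [this]; exact sum_nonneg fun b _ => mul_nonneg (hB0 b) (mul_nonneg (Bslack b) (t0 b))
  have U7 : 0 ≤ (1 - Q) * Sds - Q * Sdt := by   -- E_b[d C]
    have : (1 - Q) * Sds - Q * Sdt = ∑ b, wB b * (dB wC φ₁ φ₂ g b * ((1 - Q) * sB wA ψ h b - Q * tB wA ψ h b)) := by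
      rw [hSds, hSdt, mul_sum, mul_sum, ← sum_sub_distrib]; exact sum_congr rfl fun b _ => by ring
    rw [this]; exact sum_nonneg fun b _ => mul_nonneg (hB0 b) (mul_nonneg (d0 b) (Cslack b))
  have U8 : 0 ≤ (1 - Q) * Ss - Q * St := by   -- E_b[C]
    have : (1 - Q) * Ss - Q * St = ∑ b, wB b * ((1 - Q) * sB wA ψ h b - Q * tB wA ψ h b) := by
      rw [hSs, hSt, mul_sum, mul_sum, ← sum_sub_distrib]; exact sum_congr rfl fun b _ => by ring
    rw [this]; exact sum_nonneg fun b _ => mul_nonneg (hB0 b) (Cslack b)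
  have U9 : 0 ≤ (1 - P2) * (Sm + Sd) - P2 * Sn := by   -- E_b[B]
    have : (1 - P2) * (Sm + Sd) - P2 * Sn =
        ∑ b, wB b * ((1 - P2) * (mB wC φ₁ g b + dB wC φ₁ φ₂ g b) - P2 * nB wC φ₂ g b) := by
      rw [hSm, hSd, hSn, ← sum_add_distrib, mul_sum, mul_sum, ← sum_sub_distrib]
      exact sum_congr rfl fun b _ => by ring
    rw [this]; exact sum_nonneg fun b _ => mul_nonneg (hB0 b) (Bslack b)
  -- the nine-term identity for P2 · E_3
  have ident : P2 * (2 * (Sms + Smt + Sds) + (P1 + (P2 - P1) * Q) * (Sm + Sd + Sn) * (Ss + St)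
      - ((P1 + (P2 - P1) * Q) * (Sms + Smt + Sds + Sdt + Sns + Snt) + (Sm + Sd + Sn) * (P1 * (Ss + St) + (P2 - P1) * Ss)
        + (Ss + St) * (Sm + Q * Sd)))
      = (P2 + (P2 - P1) * (1 - Q)) * (Sms - Sm * Ss) + (P1 + (P2 - P1) * (1 - Q)) * (Smt - Sm * St) + P2 * (Sds - Sd * Ss)
        + P2 * ((1 - P1) * Smt - P1 * (Sdt + Snt)) + (P1 + (P2 - P1) * Q) * ((1 - P2) * (Sms + Sds) - P2 * Sns)
        + (P2 - P1) * Q * ((1 - P2) * (Smt + Sdt) - P2 * Snt) + (P2 - P1) * ((1 - Q) * Sds - Q * Sdt)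
        + P1 * Sd * ((1 - Q) * Ss - Q * St) + (P2 - P1) * (((1 - P2) * (Sm + Sd) - P2 * Sn) * ((1 - Q) * Ss - Q * St)) := by
    ring
  have nine : 0 ≤ P2 * (2 * (Sms + Smt + Sds) + (P1 + (P2 - P1) * Q) * (Sm + Sd + Sn) * (Ss + St)
      - ((P1 + (P2 - P1) * Q) * (Sms + Smt + Sds + Sdt + Sns + Snt) + (Sm + Sd + Sn) * (P1 * (Ss + St) + (P2 - P1) * Ss)
        + (Ss + St) * (Sm + Q * Sd))) := by
    rw [ident]
    have c1 : 0 ≤ P2 + (P2 - P1) * (1 - Q) := by nlinarith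
    have c2 : 0 ≤ P1 + (P2 - P1) * (1 - Q) := by nlinarith
    have c5 : 0 ≤ P1 + (P2 - P1) * Q := by nlinarith
    have c6 : 0 ≤ (P2 - P1) * Q := by nlinarith
    have c7 : 0 ≤ P2 - P1 := by linarith
    have hP20 : 0 ≤ P2 := hP10.trans hP12
    have u1 := mul_nonneg c1 (sub_nonneg.mpr T1)
    have u2 := mul_nonneg c2 (sub_nonneg.mpr T2)
    have u3 := mul_nonneg hP20 (sub_nonneg.mpr T3)
    have u4 := mul_nonneg hP20 U4
    have u5 := mul_nonneg c5 U5
    have u6 := mul_nonneg c6 U6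
    have u7 := mul_nonneg c7 U7
    have u8 := mul_nonneg (mul_nonneg hP10 hSd0) U8
    have u9 := mul_nonneg c7 (mul_nonneg U9 U8)
    linarith
  by_cases hP2z : P2 = 0
  · have hwφ2 : ∀ c, wC c * φ₂ c = 0 := by
      have hs : ∑ c, wC c * φ₂ c = 0 := by rw [← hP2z, hP2, PC]
      have := (sum_eq_zero_iff_of_nonneg fun c _ => mul_nonneg (hC.nonneg c) (hφ20 c)).mp hs
      exact fun c => this c (mem_univ c)
    have hwφ1 : ∀ c, wC c * φ₁ c = 0 := fun c =>
      le_antisymm ((mul_le_mul_of_nonneg_left (hle c) (hC.nonneg c)).trans (hwφ2 c).le) (mul_nonneg (hC.nonneg c) (hφ0 c))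
    have hm : ∀ b, mB wC φ₁ g b = 0 := fun b =>
      sum_eq_zero fun c _ => by rw [← mul_assoc, hwφ1 c, zero_mul]
    have hd : ∀ b, dB wC φ₁ φ₂ g b = 0 := fun b =>
      sum_eq_zero fun c _ => by rw [← mul_assoc, mul_sub, hwφ1 c, hwφ2 c, sub_zero, zero_mul]
    have z1 : Sms = 0 := by rw [hSms]; exact sum_eq_zero fun b _ => by rw [hm b]; ring
    have z2 : Smt = 0 := by rw [hSmt]; exact sum_eq_zero fun b _ => by rw [hm b]; ring
    have z3 : Sds = 0 := by rw [hSds]; exact sum_eq_zero fun b _ => by rw [hd b]; ring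
    have z4 : Sm = 0 := by rw [hSm]; exact sum_eq_zero fun b _ => by rw [hm b]; ring
    have z5 : Sd = 0 := by rw [hSd]; exact sum_eq_zero fun b _ => by rw [hd b]; ring
    have hP1z : P1 = 0 := le_antisymm (hP2z ▸ hP12) hP10
    rw [z1, z2, z3, z4, z5, hP1z, hP2z]
    ring_nf
    exact le_refl _
  · have hP2pos : 0 < P2 := lt_of_le_of_ne (hP10.trans hP12) (Ne.symm hP2z)
    exact (mul_nonneg_iff_of_pos_left hP2pos).mp nine

end Main

section Cubes

variable {A B C : Type} [Fintype A] [Fintype B] [Fintype C]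

/-- **Three Boolean cubes with product measures, staircase member** ⇒ `E_3(φ₁ + (φ₂−φ₁)⊗ψ, g, h) ≥ 0`. [this work] -/
theorem sahiE_three_nonneg_cubes_of_staircaseMember (pA : A → unitInterval) (pB : B → unitInterval) (pC : C → unitInterval)
    (φ₁ φ₂ : Set C → ℝ) (ψ : Set A → ℝ) (g : Set C → Set B → ℝ) (h : Set A → Set B → ℝ)
    (hφ0 : ∀ c, 0 ≤ φ₁ c) (hle : ∀ c, φ₁ c ≤ φ₂ c) (hφ1 : ∀ c, φ₂ c ≤ 1) (hφ1m : Monotone φ₁) (hφ2m : Monotone φ₂)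
    (hψ0 : ∀ a, 0 ≤ ψ a) (hψ1 : ∀ a, ψ a ≤ 1) (hψm : Monotone ψ)
    (hg0 : ∀ c b, 0 ≤ g c b) (hgb : ∀ c, Monotone (g c)) (hgc : ∀ b, Monotone (fun c => g c b))
    (hh0 : ∀ a b, 0 ≤ h a b) (hha : ∀ b, Monotone (fun a => h a b)) (hhb : ∀ a, Monotone (h a)) :
    0 ≤ sahiE (fun p : Set A × Set B × Set C =>
        bernoulliWeight pA p.1 * bernoulliWeight pB p.2.1 * bernoulliWeight pC p.2.2) 3
        ![fun p => φ₁ p.2.2 + (φ₂ p.2.2 - φ₁ p.2.2) * ψ p.1, fun p => g p.2.2 p.2.1, fun p => h p.1 p.2.1] :=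
  sahiE_three_nonneg_of_staircaseMember (bernoulliWeight pA) (bernoulliWeight pB) (bernoulliWeight pC) φ₁ φ₂ ψ g h
    (isFKGMeasure_bernoulliWeight pA) (isFKGMeasure_bernoulliWeight pB) (isFKGMeasure_bernoulliWeight pC)
    hφ0 hle hφ1 hφ1m hφ2m hψ0 hψ1 hψm hg0 hgb hgc hh0 hha hhb

end Cubes

end SahiTriangleStaircase

end Summit.CriticalPhenomena.PercolationContinuityZ3.Theorems
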